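import Summits.BirchSwinnertonDyer.BirchSwinnertonDyer.Theorems.RamifiedHeegnerPairTwistUnitIntrinsic
import Summits.BirchSwinnertonDyer.BirchSwinnertonDyer.Theorems.RamifiedHeegnerPairLeafRankOneUpperAtThreePartnerTwistAny
import Summits.BirchSwinnertonDyer.BirchSwinnertonDyer.Theorems.RamifiedHeegnerPairLeafRankZeroUpperAtThreePartnerTwistAny
import Summits.BirchSwinnertonDyer.Rank1Residual.Additive.IntModelTamagawaCertificateLocal
import HarnessLib

/-!
# U₁ / U₀ at the single-ADDITIVE-carrier Gss2 classes — kernel instances of the mono-carrier twist-unit road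

Seat `bsd-trib-w-rhp` g13 (TRIBUNAL-W / kit planner) for route `RamifiedHeegnerPair`; helper file `--supports` the crux U₁ `LeafRankOneUpperAtThree`
(stmt-BirchSwinnertonDyer-26022; the rank-zero parts support U₀, 26024).  **HONEST FRAMING: theorems only; per-curve certificates under DISPLAYED inputs (conductor, analytic rank, `3 ∤ c(Dt)`, twist `L`-data, `#Ш(Wd)_an`) and
the printed / named facts of the road as hypotheses; nothing is booked, no item is closed; U₁ (26022) / U₀ (26024) / TU / L₀ / L₁ stay OPEN class-wide; BSD is
NOT proved for any curve by this file.**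

## What
rhp-p2 g9's MONO-CARRIER roads (p646214 §4 `RamifiedPairUpperBound.leafRankOneUpper_three_monoCarrierAny_of_namedFacts_of_twistUnitTwoSplit`, p646215 §4₀
`…leafRankZeroUpper_three_monoCarrierAny_of_namedFacts_of_twistUnitZeroTwoSplit`) prove U₁ / U₀ at a leaf curve `W` whose `3`-part of `∏ c_ℓ` is carried by
ONE bad prime `q` OF ANY REDUCTION TYPE (`hmono : ord₃ ∏ c_ℓ ≤ ord₃ c(W/ℚ_q)`), from print (`hGZ hKo hGZK hmod [hGZ73] hMN [hmodP] hCassels`), the three NAMED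
research-level facts of the Jetchev any-carrier reading (`h37` GrossLMS1991 Prop. 3.7(2), `hPT` Poitou–Tate for Selmer structures, `hF1` Gross 1991 (4.1)),
`¬ CM`, `Addv ∧ SubGss` at `3`, `3 ∤ c(Dt)`, and the 2-SPLIT twist-unit datum `hTU` (a Heegner field with `2` split, a member, a minimal model of its twist
with `#Ш_an` a `3`-adic unit).  On the rank-one Gss2 census (trib-w g11 `TU1-CENSUS`) the classes with `ord₃ ∏ c_ℓ ≥ 1` carried by a single prime
that is ADDITIVE (Kodaira `IV`/`IV*`, `c_q = 3`) number 9 (10 curves); on the rank-zero census 43 (44 curves).  No earlier road reaches them (g7 §3 needs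
`3 ∤ ∏ c_ℓ`, g8 §4 a MULTIPLICATIVE carrier).  This file and its continuations `…TwistUnitAdditive*` instantiate §4 / §4₀ per curve:
* §0 two DOORS `twistUnitTwoSplit_of_sqrtField` / `twistUnitZeroTwoSplit_of_sqrtField`: the `hTU` shape at `K = ℚ(√D)`, `D ≡ 1 (mod 8)`, from displayed
  twist `L`-data and ONE minimal model `Wd` (`Cd • W^{(D)} = Wd`) with `#Ш(Wd)_an` of `ord₃ ≤ 0`; KERNEL field facts (`satisfiesHeegnerHypothesis_sqrtField` at
  `N` and at `2`).
* per curve (`§1, §2, …`; this part: `133956n1`): `subGss_three_<label>` (Addv ∧ SubGss at `3` IN THE KERNEL via the minimal model `V` of `E^{(-3)}`,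
  `#Ṽ(𝔽₃)`), `tamRowZ_/tamagawaProduct_<label>` (`∏ c_ℓ` IN THE KERNEL, n1011-p03 `tamcert.py` rows), `localTamagawa_<q>_<label>` (`c(E/ℚ_q) = 3` IN THE
  KERNEL through n1011-p19's `TamX` bridge — the `hmono` input), Kraus minimality of `V` and `Wd`, and `u1_at_<label>` / `u0_at_<label> : … → MissingUpperBoundAt W 3`
  (+ `bsd3_at_<label> : … → BSDp W 3` where the lower half is free, `3 ∤ #Ш(E)_an`, or exists by name).
Other roads reach `BSDp` at some of these curves under OTHER displayed inputs (X4 3-descent records `bsdp3_d<label>`, visibility records `bsdp3_visD44_v<label>`,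
Kolyvagin-index records); nothing of theirs is restated — the Tamagawa rows they hold are used BY NAME where identical.

## Data
Rank one: `D` = the least negative fundamental discriminant `≡ 1 (mod 8)` split at every odd `ℓ ∣ N` with `L(E^{(D)},1) ≠ 0` and `3 ∤ #Ш(E^{(D)})_an`
(g11 TU census kit j308272; models / changes / Kraus lists / `L`-values re-derived by kit j312631, PARI 2.15.4).  Rank zero: the least such `D` with
`ε(E^{(D)}) = -1`, a Heegner point `P ∈ E^{(D)}(ℚ)` of infinite order found by the level-`N` engine (g12 `heeg2.gp`, kit j312623) and
`X = L'(F,1)·T²/(Ω·∏c·ĥ(P)) = [F(ℚ):ℤP]²·#Ш(F)_an` an exact integer prime to `3`.  Tamagawa certificates: n1011-p03 `tools/tamcert.py` unchanged.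
[cite: MatarNekovar2019, Thm. 0.7 (p. 456)] [cite: GrossZagier1986, Thm. I.(6.3) and (7.3)] [cite: GrossLMS1991, §1 and Prop. 3.7]
[cite: KrizLi2019, Thm. 1.20] [cite: Silverman1994, IV.9.4] [cite: Tate1975, §7] [cite: Kraus1989, Prop. 1] [cite: Cremona2006, Table 1]
[cite: SilvermanAEC2009, C.11 (CM j-invariants)]
-/

set_option linter.dupNamespace false
set_option autoImplicit false

noncomputable section

open scoped Classical NumberField

open WeierstrassCurve NumberField IsDedekindDomain IsDedekindDomain.HeightOneSpectrum Rat.HeightOneSpectrum Field Literature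
  Literature.NumberTheory.DiophantineGeometry Literature.NumberTheory.EllipticCurves Literature.NumberTheory.EllipticCurves.ModularForms
  Literature.NumberTheory.EllipticCurves.Rank1Residual Literature.NumberTheory.EllipticCurves.Rank1Residual.Typed Literature.NumberTheory.Automorphic
  Literature.NumberTheory.EllipticCurves.Rank1Residual.X11RankOneCertificates Literature.NumberTheory.EllipticCurves.KrizLi2019
  Literature.NumberTheory.GaloisRepresentations Literature.NumberTheory.QuadraticFields Summit.BirchSwinnertonDyer.BirchSwinnertonDyer.Rank1Residual.IntModel
  Summit.BirchSwinnertonDyer.BirchSwinnertonDyer.Rank2Observatory.Tam Summit.BirchSwinnertonDyer.Rank1Residual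
  Summit.BirchSwinnertonDyer.Rank1Residual.Additive Summit.BirchSwinnertonDyer.Rank1Residual.X11b Summit.BirchSwinnertonDyer.Rank1Residual.X11b.Three
  Summit.BirchSwinnertonDyer.Rank1Residual.GaloisImage Summit.BirchSwinnertonDyer.Rank1Residual.Supersingular
  Summit.BirchSwinnertonDyer.BirchSwinnertonDyer.Theses.RamifiedHeegnerPair Summit.BirchSwinnertonDyer.BirchSwinnertonDyer.Theorems
  Summit.BirchSwinnertonDyer.BirchSwinnertonDyer.Theorems.SchneiderFree Summit.BirchSwinnertonDyer.BirchSwinnertonDyer.Theorems.RamifiedPairUpperBound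
  Summit.BirchSwinnertonDyer.BirchSwinnertonDyer.Theorems.RamifiedHeegnerPairStepLIntrinsic
  Summit.BirchSwinnertonDyer.BirchSwinnertonDyer.Theorems.AdditiveBranchIMCGordTwoRankOne.HeegnerKolyvagin
  Summit.BirchSwinnertonDyer.BirchSwinnertonDyer.Theorems.RamifiedHeegnerPairTwistUnitIntrinsic

namespace Summit.BirchSwinnertonDyer.BirchSwinnertonDyer.Theorems.RamifiedHeegnerPairTwistUnitAdditive

/-! ## §0 Doors: the 2-split twist-unit datum at `K = ℚ(√D)`, `D ≡ 1 (mod 8)` -/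

/-- **DOOR (rank one): the 2-SPLIT twist-unit datum TU₁|₂ at `K = ℚ(√D)`, `D ≡ 1 (mod 8)`.** Data: `D < 0` squarefree with `D ≡ 1 (mod 8)`
(so `2` SPLITS in `K = sqrtField D`: `SatisfiesHeegnerHypothesis 2 K`) and `(D/ℓ) = 1` for every odd prime `ℓ ∣ N` (every `ℓ ∣ N` splits, `d_K = D` odd),
the conductor value `N` (displayed), `L(W^{(D)},1) ≠ 0`, and ONE globally minimal model `Wd` of the twist (`Cd • W^{(D)} = Wd`) with `#Ш(Wd)_an = qd`,
`ord₃ qd ≤ 0`.  The member is `W` itself (`IsIsogenous.refl`).  Output = the `hTU` hypothesis of rhp-p2 g9 §4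
`RamifiedPairUpperBound.leafRankOneUpper_three_monoCarrierAny_of_namedFacts_of_twistUnitTwoSplit`, verbatim.  KERNEL:
`isImaginaryQuadratic_and_discr_sqrtField`, `satisfiesHeegnerHypothesis_sqrtField` (at `N` and at `2`). (g11's door `twistUnitFieldAt_of_sqrtField` is the
same construction without the 2-split clause.) [cite: GrossLMS1991, §1] [cite: KrizLi2019, Thm. 1.20] [cite: Cox2013, §5.B] -/
theorem twistUnitTwoSplit_of_sqrtField (W : WeierstrassCurve ℚ) [W.IsElliptic] [W.IsGloballyMinimal]
    (N : ℕ) (D : ℤ) [hD : Fact (D < 0)] (hD8 : D % 8 = 1) (hsfN : Squarefree D.natAbs)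
    (hjac : ∀ ℓ : ℕ, ℓ.Prime → ℓ ∣ N → ℓ ≠ 2 → jacobiSym D ℓ = 1)
    (hN : W.conductorNorm ℤ = N) (hLt : (W.quadraticTwist (D : ℚ)).entireLFunction 1 ≠ 0)
    (Wd : WeierstrassCurve ℚ) [Wd.IsElliptic] [Wd.IsGloballyMinimal] (Cd : VariableChange ℚ)
    (hWd : Cd • W.quadraticTwist (D : ℚ) = Wd) {qd : ℚ} (hqd : shaAn Wd = (qd : ℂ)) (hvd : padicValRat 3 qd ≤ 0) :
    ∃ (K : Type) (_ : Field K) (_ : NumberField K) (W₂ W₂d : WeierstrassCurve ℚ) (_ : W₂.IsElliptic)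
      (_ : W₂.IsGloballyMinimal) (_ : W₂d.IsElliptic) (_ : W₂d.IsGloballyMinimal),
      IsImaginaryQuadratic K ∧ Odd (NumberField.discr K) ∧ SatisfiesHeegnerHypothesis (W.conductorNorm ℤ) K ∧
      SatisfiesHeegnerHypothesis 2 K ∧ (W.quadraticTwist (NumberField.discr K : ℚ)).entireLFunction 1 ≠ 0 ∧
      IsIsogenous W W₂ ∧ (∃ C : VariableChange ℚ, C • W₂.quadraticTwist (NumberField.discr K : ℚ) = W₂d) ∧
      ∃ qd : ℚ, shaAn W₂d = (qd : ℂ) ∧ padicValRat 3 qd ≤ 0 := by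
  have hsf : Squarefree D := Int.squarefree_natAbs.mp hsfN
  obtain ⟨hK, hdisc⟩ := isImaginaryQuadratic_and_discr_sqrtField D (by omega) hsf
  have hHN : SatisfiesHeegnerHypothesis N (sqrtField D) := satisfiesHeegnerHypothesis_sqrtField D hD8 hsf hjac
  have hH2 : SatisfiesHeegnerHypothesis 2 (sqrtField D) :=
    satisfiesHeegnerHypothesis_sqrtField D hD8 hsf (N := 2)
      (fun ℓ hℓ hℓ2 hne => absurd ((Nat.prime_dvd_prime_iff_eq hℓ Nat.prime_two).mp hℓ2) hne)
  have hodd : Odd (NumberField.discr (sqrtField D)) := by rw [hdisc, Int.odd_iff]; omega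
  refine ⟨sqrtField D, inferInstance, inferInstance, W, Wd, ‹_›, ‹_›, ‹_›, ‹_›, hK, hodd, ?_, hH2, ?_, IsIsogenous.refl_holds W,
    ⟨Cd, ?_⟩, qd, hqd, hvd⟩
  · rw [hN]; exact hHN
  · rw [hdisc]; exact hLt
  · rw [hdisc]; exact hWd

/-- **DOOR (rank zero): the 2-SPLIT twist-unit datum TU₀|₂ at `K = ℚ(√D)`, `D ≡ 1 (mod 8)`.** As `twistUnitTwoSplit_of_sqrtField` with the
rank-zero analytic data of the twist: `L(W^{(D)},1) = 0` and `L'(W^{(D)},1) ≠ 0` (displayed by the consumer).  Output = the `hTU` hypothesis of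
rhp-p2 g9 §4₀ `RamifiedPairUpperBound.leafRankZeroUpper_three_monoCarrierAny_of_namedFacts_of_twistUnitZeroTwoSplit`, verbatim.
[cite: GrossLMS1991, §1] [cite: GrossZagier1986, Thm. I.(6.3)] [cite: Cox2013, §5.B] -/
theorem twistUnitZeroTwoSplit_of_sqrtField (W : WeierstrassCurve ℚ) [W.IsElliptic] [W.IsGloballyMinimal]
    (N : ℕ) (D : ℤ) [hD : Fact (D < 0)] (hD8 : D % 8 = 1) (hsfN : Squarefree D.natAbs)
    (hjac : ∀ ℓ : ℕ, ℓ.Prime → ℓ ∣ N → ℓ ≠ 2 → jacobiSym D ℓ = 1)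
    (hN : W.conductorNorm ℤ = N) (hL0 : (W.quadraticTwist (D : ℚ)).entireLFunction 1 = 0)
    (hL1 : deriv (W.quadraticTwist (D : ℚ)).entireLFunction 1 ≠ 0)
    (Wd : WeierstrassCurve ℚ) [Wd.IsElliptic] [Wd.IsGloballyMinimal] (Cd : VariableChange ℚ)
    (hWd : Cd • W.quadraticTwist (D : ℚ) = Wd) {qd : ℚ} (hqd : shaAn Wd = (qd : ℂ)) (hvd : padicValRat 3 qd ≤ 0) :
    ∃ (K : Type) (_ : Field K) (_ : NumberField K) (W₂ W₂d : WeierstrassCurve ℚ) (_ : W₂.IsElliptic)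
      (_ : W₂.IsGloballyMinimal) (_ : W₂d.IsElliptic) (_ : W₂d.IsGloballyMinimal),
      IsImaginaryQuadratic K ∧ Odd (NumberField.discr K) ∧ SatisfiesHeegnerHypothesis (W.conductorNorm ℤ) K ∧
      SatisfiesHeegnerHypothesis 2 K ∧ (W.quadraticTwist (NumberField.discr K : ℚ)).entireLFunction 1 = 0 ∧
      deriv (W.quadraticTwist (NumberField.discr K : ℚ)).entireLFunction 1 ≠ 0 ∧
      IsIsogenous W W₂ ∧ (∃ C : VariableChange ℚ, C • W₂.quadraticTwist (NumberField.discr K : ℚ) = W₂d) ∧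
      ∃ qd : ℚ, shaAn W₂d = (qd : ℂ) ∧ padicValRat 3 qd ≤ 0 := by
  have hsf : Squarefree D := Int.squarefree_natAbs.mp hsfN
  obtain ⟨hK, hdisc⟩ := isImaginaryQuadratic_and_discr_sqrtField D (by omega) hsf
  have hHN : SatisfiesHeegnerHypothesis N (sqrtField D) := satisfiesHeegnerHypothesis_sqrtField D hD8 hsf hjac
  have hH2 : SatisfiesHeegnerHypothesis 2 (sqrtField D) :=
    satisfiesHeegnerHypothesis_sqrtField D hD8 hsf (N := 2)
      (fun ℓ hℓ hℓ2 hne => absurd ((Nat.prime_dvd_prime_iff_eq hℓ Nat.prime_two).mp hℓ2) hne)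
  have hodd : Odd (NumberField.discr (sqrtField D)) := by rw [hdisc, Int.odd_iff]; omega
  refine ⟨sqrtField D, inferInstance, inferInstance, W, Wd, ‹_›, ‹_›, ‹_›, ‹_›, hK, hodd, ?_, hH2, ?_, ?_, IsIsogenous.refl_holds W,
    ⟨Cd, ?_⟩, qd, hqd, hvd⟩
  · rw [hN]; exact hHN
  · rw [hdisc]; exact hL0
  · rw [hdisc]; exact hL1
  · rw [hdisc]; exact hWd

/-! ## §1 `133956n1` = `[0, 0, 0, 33489, -36770922]`, `N = 133956 = 2^2·3^2·61^2` (`2`: IV*, `c = 3`, `3`: I₀*, `c = 2`, `61`: I1*, `c = 4`); `∏ c_ℓ = 24`, single carrier `q = 2` (IV*, ADDITIVE, `c_2 = 3`);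
`r_an = 1`, `#E(ℚ)_tors = 1`, `#Ш(E)_an = 9` (Cremona/LMFDB, displayed where used); class `133956n` of size 1.
`V = E^{(-3)}_min = [0, 0, 0, 3721, 1361886]` (`#Ṽ(𝔽₃) = 4`), `K = ℚ(√-47)`, `Wd = E^{(-47)}_min = [0, 0, 0, 73977201, 3817667434806]`: `L(E^{(-47)},1) = 1.5645411526 ≠ 0` (g11 TU census kit j308272: PARI `ellL1`, and EXACTLY `L(F,1)/Ω⁺ = 48` by Sage modular symbols for the class), `#Ш(Wd)_an = L/(Ω·∏c/T²) = 1` (`N(Wd) = 295908804 = N·47²`, root number `1`, `∏c(Wd) = 48`, `#Wd(ℚ)_tors = 1`; BSD data of `Wd` by kit j312919, PARI 2.15.4). -/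

/-- Row certificate of `133956n1` (stage-1 `TamLocal` at every bad prime, stage-2 `TamX` at the `IV`/`IV*` prime, stage-3 `TamZ` at the `I₀*`/`Iₙ*` primes):
checks in the kernel; emitted by n1011-p03 `tools/tamcert.py`, unchanged. [cite: Silverman1994, IV.9.4 Steps 2–7] [cite: Tate1975, §7] [cite: Cremona2006, Table 1 (Cremona label 133956n1)] -/
theorem tamRowZ_133956n1 :
    TamZ.rowCheckZ [⟨2, 1, 5, 0, 3, 1, 2, 8, 8, 0, 3⟩, ⟨3, 1, 5, 0, 0, 0, 0, 6, 6, 0, 2⟩, ⟨61, 7, 5, 0, 1647, 0, 0, 7, 71, 0, 4⟩]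
      [⟨2, 1, 3, 3, 1, 2, 8, 0⟩] [⟨3, 9, 0, 0, 0, 6, 0, 1⟩, ⟨61, 5, 1647, 0, 0, 7, 0, 18⟩] (⟨0, 0, 0, 33489, -36770922⟩ : WeierstrassCurve ℤ) = true := by
  decide +kernel

/-- **`∏_ℓ c_ℓ(133956n1) = 24` IN THE KERNEL** for any globally minimal `W / ℚ` with this integral model (Cremona: `24`; `ord₃ = 1`). [cite: Silverman1994, IV.9.4] -/
theorem tamagawaProduct_133956n1 {W : WeierstrassCurve ℚ} [W.IsGloballyMinimal]
    (hI : integralModelInt W = (⟨0, 0, 0, 33489, -36770922⟩ : WeierstrassCurve ℤ)) : W.tamagawaProduct = 24 :=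
  (IntModelTam.tamagawaProduct_eq_rowValueZ_of_intModel hI tamRowZ_133956n1 (by decide +kernel)).trans (by decide +kernel)

/-- **`c(W/ℚ_2) = 3` IN THE KERNEL** (the carrier's LOCAL Tamagawa number) for any globally minimal `W / ℚ` with this model: Tate's algorithm at `2` to its
exit (type IV*, `TamX` certificate, `c = 3`) through n1011-p19's bridge `IntModelTam.localTamagawaNumber_padic_eq_of_intModel_of_tamX`; the `hmono` input of the
mono-carrier road (`ord₃ ∏ c_ℓ = 1 = ord₃ c_2`). [cite: Silverman1994, IV.9.4] [cite: Tate1975, §7] [cite: Cremona2006, Table 1 (Cremona label 133956n1)] -/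
theorem localTamagawa_two_133956n1 {W : WeierstrassCurve ℚ} [W.IsElliptic] [W.IsGloballyMinimal]
    (hI : integralModelInt W = (⟨0, 0, 0, 33489, -36770922⟩ : WeierstrassCurve ℤ)) :
    haveI : Fact (Nat.Prime 2) := ⟨by norm_num⟩
    (W.baseChange ℚ_[2]).localTamagawaNumber ℤ_[2] = 3 :=
  haveI : Fact (Nat.Prime 2) := ⟨by norm_num⟩
  (IntModelTam.localTamagawaNumber_padic_eq_of_intModel_of_tamX hI 2 (F := ⟨2, 1, 3, 3, 1, 2, 8, 0⟩) rfl (by decide +kernel)).trans (by decide)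

/-- **U₁ AT `133956n1` BY THE MONO-CARRIER TWIST-UNIT ROAD** — `MissingUpperBoundAt W 3` (`ord₃ #Ш(E) ≤ ord₃ #Ш(E)_an`) at `W = E` from rhp-p2 g9 §4
`RamifiedPairUpperBound.leafRankOneUpper_three_monoCarrierAny_of_namedFacts_of_twistUnitTwoSplit` (p646214): PRINTED binders `hGZ hKo hGZK hmod hGZ73 hMN hCassels`
(Gross–Zagier ∀, Kolyvagin ∀, GZK, Version L, GZ I.(7.3), Matar–Nekovář 2019 Thm 0.7 irreducible form, Cassels) and the three NAMED tree facts `h37 hPT hF1`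
(GrossLMS1991 Prop. 3.7(2), Poitou–Tate for Selmer structures, Gross 1991 (4.1) — research-level inputs of the Jetchev any-carrier reading, displayed BY NAME);
KERNEL: `∏ c_ℓ(E) = 24` (`tamagawaProduct_133956n1`) and `c(E/ℚ_2) = 3` (`localTamagawa_two_133956n1`) so `hmono` holds with the single ADDITIVE carrier `q = 2` (IV*),
`¬ CM` (`j = 432/61` is none of the thirteen CM `j`-invariants), `Addv ∧ SubGss` at `3` (RamifiedHeegnerPairStepLIntrinsic.subGss_three_133956n1), the field `K = ℚ(√-47)`
(`-47 ≡ 1 (mod 8)`: `2` and every `ℓ ∣ N` split; `47` prime), the twist identity `Cd • E^{(-47)} = Wd`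
(`Cd = [1, 0, 0, 0]`) and Kraus minimality of `Wd` (`Summit.BirchSwinnertonDyer.BirchSwinnertonDyer.Theorems.RamifiedHeegnerPairStepLIntrinsic.isGloballyMinimal_sWd133956n1`); DISPLAYED: `N(E) = 133956` (`hN`), `r_an(E) = 1` (`hr`), `Dt` with `3 ∤ c(Dt)`
(`hc`; Manin constant `1` for this optimal curve), `L(E^{(-47)},1) ≠ 0` (`hLt`) and `#Ш(Wd)_an = 1` (`hqd`/`hvd`) — numerics in the section header.
NO S2, NO Σ, NO L₀.  A per-curve certificate; U₁ (stmt 26022) stays OPEN class-wide; BSD is NOT proved by this. [cite: MatarNekovar2019, Thm. 0.7 (p. 456) and §0.11]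
[cite: GrossZagier1986, Thm. I.(6.3) and (7.3)] [cite: GrossLMS1991, Prop. 3.7] [cite: Miller2011LMS, Def. 1.1] [cite: Cremona2006, Table 1 (Cremona label 133956n1)] -/
theorem u1_at_133956n1
    (hGZ : ∀ (N : ℕ) [NeZero N] (W : WeierstrassCurve ℚ) (K : Type) [Field K] [NumberField K], gross_zagier N W K)
    (hKo : ∀ (N : ℕ) [NeZero N] (W : WeierstrassCurve ℚ) (K : Type) [Field K] [NumberField K], kolyvagin N W K)
    (hGZK : rank_eq_analyticRank_of_analyticRank_le_one) (hmod : hasEntireLFunction_rat) (hGZ73 : GrossZagier1986_thm_I_7_3)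
    (hMN : MatarNekovar2019.thm07_padicValNat_card_sha_primary_add_le_of_globalDivisibility_of_irreducible)
    (hCassels : bsdRHS_eq_of_isIsogenous) (h37 : GrossLMS1991.prop37_2_frobeniusCongruence)
    (hPT : ∀ (K : Type) [Field K] [NumberField K], Literature.NumberTheory.GaloisCohomology.poitouTate_selmerStructure_duality_conj K)
    (hF1 : Gross1991_heegnerPoint_sub_ratTorsion_mem_E0_imageFree)
    {W : WeierstrassCurve ℚ} [W.IsElliptic] [W.IsGloballyMinimal] (hWeq : W = (⟨0, 0, 0, 33489, -36770922⟩ : WeierstrassCurve ℚ))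
    (hN : W.conductorNorm ℤ = 133956) [NeZero (W.conductorNorm ℤ)] (hr : W.analyticRank = 1)
    (Dt : ModularParametrizationData W (W.conductorNorm ℤ)) (hc : ¬ (3 : ℤ) ∣ Dt.c)
    (hLt : (W.quadraticTwist ((-47 : ℤ) : ℚ)).entireLFunction 1 ≠ 0)
    {qd : ℚ} (hqd : haveI := Summit.BirchSwinnertonDyer.BirchSwinnertonDyer.Theorems.RamifiedHeegnerPairStepLIntrinsic.isElliptic_sWd133956n1; shaAn (⟨0, 0, 0, 73977201, 3817667434806⟩ : WeierstrassCurve ℚ) = (qd : ℂ))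
    (hvd : padicValRat 3 qd ≤ 0) :
    MissingUpperBoundAt W 3 := by
  subst hWeq
  haveI := Summit.BirchSwinnertonDyer.BirchSwinnertonDyer.Theorems.RamifiedHeegnerPairStepLIntrinsic.isElliptic_sWd133956n1; haveI := Summit.BirchSwinnertonDyer.BirchSwinnertonDyer.Theorems.RamifiedHeegnerPairStepLIntrinsic.isGloballyMinimal_sWd133956n1
  haveI : Fact ((-47 : ℤ) < 0) := ⟨by norm_num⟩
  haveI : Fact (Nat.Prime 2) := ⟨by norm_num⟩
  have hjac : ∀ ℓ : ℕ, ℓ.Prime → ℓ ∣ 133956 → ℓ ≠ 2 → jacobiSym (-47) ℓ = 1 := by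
    intro ℓ hℓ hℓN hℓ2
    have hmem : ℓ ∈ Nat.primeFactors 133956 := Nat.mem_primeFactors.mpr ⟨hℓ, hℓN, by norm_num⟩
    have hpf : Nat.primeFactors 133956 = {2, 3, 61} := by decide +kernel
    rw [hpf] at hmem
    simp only [Finset.mem_insert, Finset.mem_singleton] at hmem
    rcases hmem with rfl | rfl | rfl
    · exact absurd rfl hℓ2
    all_goals (rw [jacobiSym.mod_left]; norm_num [jacobiSym.mod_left])
  have hWd : (⟨1, (0 : ℚ), (0 : ℚ), (0 : ℚ)⟩ : VariableChange ℚ) •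
      (⟨0, 0, 0, 33489, -36770922⟩ : WeierstrassCurve ℚ).quadraticTwist ((-47 : ℤ) : ℚ) =
        (⟨0, 0, 0, 73977201, 3817667434806⟩ : WeierstrassCurve ℚ) := by
    push_cast
    ext <;> simp [WeierstrassCurve.variableChange_a₁, WeierstrassCurve.variableChange_a₂,
      WeierstrassCurve.variableChange_a₃, WeierstrassCurve.variableChange_a₄, WeierstrassCurve.variableChange_a₆,
      WeierstrassCurve.quadraticTwist, WeierstrassCurve.b₂, WeierstrassCurve.b₄, WeierstrassCurve.b₆] <;> norm_num
  have hTU := twistUnitTwoSplit_of_sqrtField _ 133956 (-47) (by norm_num)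
    (by rw [show (-47 : ℤ).natAbs = 47 by rfl, Nat.squarefree_iff_nodup_primeFactorsList (by norm_num)]; simp)
    hjac hN hLt _ _ hWd hqd hvd
  have hI : integralModelInt (⟨0, 0, 0, 33489, -36770922⟩ : WeierstrassCurve ℚ) = (⟨0, 0, 0, 33489, -36770922⟩ : WeierstrassCurve ℤ) :=
    integralModelInt_eq_of_map_eq _ (map_mk_int 0 0 0 33489 (-36770922))
  have hmono : padicValNat 3 (⟨0, 0, 0, 33489, -36770922⟩ : WeierstrassCurve ℚ).tamagawaProduct ≤
      padicValNat 3 (((⟨0, 0, 0, 33489, -36770922⟩ : WeierstrassCurve ℚ).baseChange ℚ_[2]).localTamagawaNumber ℤ_[2]) := by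
    rw [tamagawaProduct_133956n1 hI, localTamagawa_two_133956n1 hI]
    exact le_of_eq (IntModelTam.padicValNat_eq_padicValNat_of_eq_mul (m := 8) Nat.prime_three (by norm_num) (by norm_num) (by norm_num))
  have hqN : 2 ∣ (⟨0, 0, 0, 33489, -36770922⟩ : WeierstrassCurve ℚ).conductorNorm ℤ := by rw [hN]; norm_num
  have hCM : ¬ (⟨0, 0, 0, 33489, -36770922⟩ : WeierstrassCurve ℚ).HasCM := fun hCM ↦ by
    have hj := (WeierstrassCurve.hasCM_iff_j_mem_holds (⟨0, 0, 0, 33489, -36770922⟩ : WeierstrassCurve ℚ)).1 hCM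
    rw [WeierstrassCurve.j, Units.val_inv_eq_inv_val, WeierstrassCurve.coe_Δ'] at hj
    simp only [cmJInvariants, Finset.mem_insert, Finset.mem_singleton] at hj
    norm_num [WeierstrassCurve.Δ, WeierstrassCurve.b₂, WeierstrassCurve.b₄, WeierstrassCurve.b₆, WeierstrassCurve.b₈,
      WeierstrassCurve.c₄] at hj
  have hGS := RamifiedHeegnerPairStepLIntrinsic.subGss_three_133956n1
  exact leafRankOneUpper_three_monoCarrierAny_of_namedFacts_of_twistUnitTwoSplit hGZ hKo hGZK hmod hGZ73 hMN hCassels h37 hPT hF1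
    _ hCM hGS.1 hGS.2 hr 2 hqN hmono Dt hc hTU

/-- **BSD₃ AT `133956n1` modulo print, the named facts and displayed numerics** — `BSDp W 3` from `u1_at_133956n1` (upper half; this is the one intrinsic
class the Tamagawa-free twist-unit road of g11 could not reach: `c₂ = 3` at the additive prime `2`) and g8's LOWER half
`RamifiedHeegnerPairL1Intrinsic.lowerHalf_three_133956n1` (`9 ∣ #Ш(E)` from the rigorous 3-descent certificate `27 ∣ #Sel₃(E)`, displayed as `hSel`, with
`#Ш(E)_an = q`, `ord₃ q ≤ 2`), glued by `Typed.missingPPartAt_of_lower_of_upper` + `Typed.bsdp_of_missingPPartAt`.  Per curve, CONDITIONAL on every displayed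
input; nothing booked; BSD is NOT proved by this. [cite: Miller2011LMS, Def. 1.1] [cite: SchaeferStoll2004, Cor. 5.9] [cite: Cremona2006, Table 1 (Cremona label 133956n1)] -/
theorem bsd3_at_133956n1
    (hGZ : ∀ (N : ℕ) [NeZero N] (W : WeierstrassCurve ℚ) (K : Type) [Field K] [NumberField K], gross_zagier N W K)
    (hKo : ∀ (N : ℕ) [NeZero N] (W : WeierstrassCurve ℚ) (K : Type) [Field K] [NumberField K], kolyvagin N W K)
    (hGZK : rank_eq_analyticRank_of_analyticRank_le_one) (hmod : hasEntireLFunction_rat) (hGZ73 : GrossZagier1986_thm_I_7_3)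
    (hMN : MatarNekovar2019.thm07_padicValNat_card_sha_primary_add_le_of_globalDivisibility_of_irreducible)
    (hCassels : bsdRHS_eq_of_isIsogenous) (h37 : GrossLMS1991.prop37_2_frobeniusCongruence)
    (hPT : ∀ (K : Type) [Field K] [NumberField K], Literature.NumberTheory.GaloisCohomology.poitouTate_selmerStructure_duality_conj K)
    (hF1 : Gross1991_heegnerPoint_sub_ratTorsion_mem_E0_imageFree)
    {W : WeierstrassCurve ℚ} [W.IsElliptic] [W.IsGloballyMinimal] (hWeq : W = (⟨0, 0, 0, 33489, -36770922⟩ : WeierstrassCurve ℚ))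
    (hN : W.conductorNorm ℤ = 133956) [NeZero (W.conductorNorm ℤ)] (hr : W.analyticRank = 1)
    {q : ℚ} (hq : shaAn W = (q : ℂ)) (hv : padicValRat 3 q ≤ 2) (hSel : 3 ^ 3 ∣ Nat.card (W.selmerGroup 3))
    (Dt : ModularParametrizationData W (W.conductorNorm ℤ)) (hc : ¬ (3 : ℤ) ∣ Dt.c)
    (hLt : (W.quadraticTwist ((-47 : ℤ) : ℚ)).entireLFunction 1 ≠ 0)
    {qd : ℚ} (hqd : haveI := Summit.BirchSwinnertonDyer.BirchSwinnertonDyer.Theorems.RamifiedHeegnerPairStepLIntrinsic.isElliptic_sWd133956n1; shaAn (⟨0, 0, 0, 73977201, 3817667434806⟩ : WeierstrassCurve ℚ) = (qd : ℂ))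
    (hvd : padicValRat 3 qd ≤ 0) :
    BSDp W 3 := by
  have hup : MissingUpperBoundAt W 3 := u1_at_133956n1 hGZ hKo hGZK hmod hGZ73 hMN hCassels h37 hPT hF1 hWeq hN hr Dt hc hLt hqd hvd
  subst hWeq
  have hlow : MissingLowerBoundAt (⟨0, 0, 0, 33489, -36770922⟩ : WeierstrassCurve ℚ) 3 :=
    RamifiedHeegnerPairL1Intrinsic.lowerHalf_three_133956n1 hGZK hr hq hv hSel
  exact Typed.bsdp_of_missingPPartAt _ 3 hGZK hr.le (Typed.missingPPartAt_of_lower_of_upper _ 3 hlow hup)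

end Summit.BirchSwinnertonDyer.BirchSwinnertonDyer.Theorems.RamifiedHeegnerPairTwistUnitAdditive

end
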